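import Summits.QuantumAdvantage.QuantumAdvantage.Theorems.LinnikCubicClassGroupsDegreeOnePrimesEscapeConjClassShortInterval
import HarnessLib

/-!
# The Chebotarev density theorem in short intervals: Siegel-free bounds, primes in short intervals, odd degree

Topic `Summits/QuantumAdvantage/QuantumAdvantage/Theorems`, cell B2b-1 (linnik-cubic), PART A (gen 17); helper
toward the crux `DegreeOnePrimesEscape` (stmt-QuantumAdvantage-11543) of route `LinnikCubicClassGroups`.
HONEST FRAMING: the value of this file is a THEOREM (kernel-checked, unconditional) — NOT summit progress.

Corollaries of `frobeniusClass_shortInterval` (`…ConjClassShortInterval.lean`), with `δ_C = |C(σ)|/|G|`,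
`Δ = S(x+h) − S(x)`, `S(y) = Σ_{p ≤ y, p ∤ d_N, Frob_p ∈ C(σ)} log p`, for `x ≥ |d_N|^L`, `x^{1−δ} ≤ h ≤ x`:
* `frobeniusClass_shortInterval_bounds` — `Δ ≤ (2+κ) δ_C h` ALWAYS (Brun–Titchmarsh shape in short intervals),
  and `Δ ≥ (1−κ) δ_C h` unless `ζ_N` has an exceptional zero `β₁` with `ζ_{N^{⟨σ⟩}}(β₁) = 0`;
* `exists_prime_frobenius_mem_shortInterval` — under the same proviso there is a prime `p ∈ (x, x+h]`, `p ∤ d_N`,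
  with `Frob_p ∈ C(σ)`;
* `frobeniusClass_shortInterval_of_odd`, `exists_prime_frobenius_mem_shortInterval_of_odd` — for Galois fields
  of ODD degree there is no exceptional zero (Stark; `classGroupLFunction_ne_zero_of_odd`), so
  `|Δ − δ_C h| ≤ κ δ_C h` and every `(x, x+h]` contains such a prime, for EVERY conjugacy class, unconditionally.
References: G. Hoheisel (1930); A. Balog, K. Ono, J. Number Theory 91 (2001); S. Gun, S. L. Naik, arXiv:2405.04698
(2024), Thm. 7; [Stark1974, Thm. 3]; [LagariasMontgomeryOdlyzko1979, Thm. 1.1].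
-/

noncomputable section

open scoped NumberField nonZeroDivisors Classical
open Finset Real Ideal NumberField IsDedekindDomain
open Literature.NumberTheory.NumberFields Literature.NumberTheory.LFunctions
  Literature.NumberTheory.LFunctions.NumberField Literature.NumberTheory.GaloisRepresentations

namespace Summit.QuantumAdvantage.QuantumAdvantage.Theorems.DegreeOnePrimesEscape

/-- `0 ≤ ((x+h)^β − x^β)/β ≤ h` for `1 ≤ x`, `0 ≤ h`, `0 < β ≤ 1`. -/
theorem rpow_window_div_mem {x h β : ℝ} (hx : 1 ≤ x) (hh : 0 ≤ h) (hβ0 : 0 < β) (hβ1 : β ≤ 1) :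
    0 ≤ ((x + h) ^ β - x ^ β) / β ∧ ((x + h) ^ β - x ^ β) / β ≤ h := by
  have hx0 : 0 < x := by linarith
  refine ⟨div_nonneg ?_ hβ0.le, (rpow_window_div_le hx0 hh hβ0 hβ1).trans ?_⟩
  · have := Real.rpow_le_rpow hx0.le (show x ≤ x + h by linarith) hβ0.le
    linarith
  · have h1 : x ^ (β - 1) ≤ 1 := Real.rpow_le_one_of_one_le_of_nonpos hx (by linarith)
    have := mul_le_mul_of_nonneg_left h1 hh
    linarith

/-- **Siegel-free bounds for the Chebotarev count in short intervals.**  With the data of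
`frobeniusClass_shortInterval`: `Δ ≤ (2+κ)δ_C h` always, and `(1−κ)δ_C h ≤ Δ` provided every real zero `β₁` of
`ζ₁_N` in the window has `ζ₁_{N^{⟨σ⟩}}(β₁) ≠ 0`. -/
theorem frobeniusClass_shortInterval_bounds (n : ℕ) (hn : 1 < n) {κ : ℝ} (hκ : 0 < κ) (hκ1 : κ ≤ 1) :
    ∃ δ L c : ℝ, 0 < δ ∧ δ ≤ 1 / 64 ∧ 0 < L ∧ 0 < c ∧ c ≤ 1 / (8 * ((2 * n).factorial : ℝ)) ∧
      ∀ (N : Type) [Field N] [NumberField N] [IsGalois ℚ N], Module.finrank ℚ N = n → ∀ σ : N ≃ₐ[ℚ] N,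
      ∀ x h : ℝ, ((NumberField.discr N).natAbs : ℝ) ^ L ≤ x → x ^ (1 - δ) ≤ h → h ≤ x →
        ((∑ p ∈ (Nat.primesLE ⌊x + h⌋₊).filter
            (fun p : ℕ => ¬ ((p : ℤ) ∣ NumberField.discr N) ∧
              ∃ (Q : Ideal (𝓞 N)) (_ : Q.IsMaximal) (_ : Q.LiesOver (span {(p : ℤ)})) (φ g : N ≃ₐ[ℚ] N),
                IsArithFrobAt ℤ φ Q ∧ Q.inertia (N ≃ₐ[ℚ] N) = ⊥ ∧ g * φ * g⁻¹ = σ), Real.log p) -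
          (∑ p ∈ (Nat.primesLE ⌊x⌋₊).filter
            (fun p : ℕ => ¬ ((p : ℤ) ∣ NumberField.discr N) ∧
              ∃ (Q : Ideal (𝓞 N)) (_ : Q.IsMaximal) (_ : Q.LiesOver (span {(p : ℤ)})) (φ g : N ≃ₐ[ℚ] N),
                IsArithFrobAt ℤ φ Q ∧ Q.inertia (N ≃ₐ[ℚ] N) = ⊥ ∧ g * φ * g⁻¹ = σ), Real.log p) ≤
          (2 + κ) * ((Nat.card {τ : N ≃ₐ[ℚ] N // IsConj σ τ} : ℝ) / Nat.card (N ≃ₐ[ℚ] N) * h)) ∧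
        ((∀ β₁ : ℝ, dedekindZeta₁ N β₁ = 0 →
            1 - c / (Real.log ((NumberField.discr N).natAbs : ℝ) + Real.log 4) < β₁ → β₁ < 1 →
            dedekindZeta₁ (IntermediateField.fixedField (Subgroup.zpowers σ)) β₁ ≠ 0) →
          (1 - κ) * ((Nat.card {τ : N ≃ₐ[ℚ] N // IsConj σ τ} : ℝ) / Nat.card (N ≃ₐ[ℚ] N) * h) ≤
          (∑ p ∈ (Nat.primesLE ⌊x + h⌋₊).filter
            (fun p : ℕ => ¬ ((p : ℤ) ∣ NumberField.discr N) ∧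
              ∃ (Q : Ideal (𝓞 N)) (_ : Q.IsMaximal) (_ : Q.LiesOver (span {(p : ℤ)})) (φ g : N ≃ₐ[ℚ] N),
                IsArithFrobAt ℤ φ Q ∧ Q.inertia (N ≃ₐ[ℚ] N) = ⊥ ∧ g * φ * g⁻¹ = σ), Real.log p) -
          (∑ p ∈ (Nat.primesLE ⌊x⌋₊).filter
            (fun p : ℕ => ¬ ((p : ℤ) ∣ NumberField.discr N) ∧
              ∃ (Q : Ideal (𝓞 N)) (_ : Q.IsMaximal) (_ : Q.LiesOver (span {(p : ℤ)})) (φ g : N ≃ₐ[ℚ] N),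
                IsArithFrobAt ℤ φ Q ∧ Q.inertia (N ≃ₐ[ℚ] N) = ⊥ ∧ g * φ * g⁻¹ = σ), Real.log p)) := by
  obtain ⟨δ, L, c, hδ0, hδ64, hL0, hc0, hc4, hcfac, hmain⟩ := frobeniusClass_shortInterval n hn hκ hκ1
  refine ⟨δ, L, c, hδ0, hδ64, hL0, hc0, hcfac, fun N _ _ _ hN σ x h hx hhx hhx' => ?_⟩
  obtain ⟨hA, hB⟩ := hmain N hN σ x h hx hhx hhx'
  have hN1 : 1 < Module.finrank ℚ N := by rw [hN]; exact hn
  set dC : ℝ := (Nat.card {τ : N ≃ₐ[ℚ] N // IsConj σ τ} : ℝ) / Nat.card (N ≃ₐ[ℚ] N) with hdC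
  have hdC0 : 0 ≤ dC := by rw [hdC]; positivity
  have hd3 : (3 : ℝ) ≤ ((NumberField.discr N).natAbs : ℝ) := three_le_natAbs_discr_real N hN1
  have hd1 : (1 : ℝ) ≤ ((NumberField.discr N).natAbs : ℝ) := by linarith
  have hx1 : 1 ≤ x := le_trans (Real.one_le_rpow hd1 hL0.le) hx
  have hx0 : 0 < x := by linarith
  have hh0 : 0 ≤ h := le_trans (Real.rpow_nonneg hx0.le _) hhx
  have hdCh : 0 ≤ dC * h := mul_nonneg hdC0 hh0
  have hlogd : 0 < Real.log ((NumberField.discr N).natAbs : ℝ) := Real.log_pos (by linarith)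
  have hlog4 : 0 < Real.log 4 := Real.log_pos (by norm_num)
  by_cases hz : ∃ β₁ : ℝ, dedekindZeta₁ N β₁ = 0 ∧
      1 - c / (Real.log ((NumberField.discr N).natAbs : ℝ) + Real.log 4) < β₁ ∧ β₁ < 1
  · obtain ⟨β₁, hζ, hwin, hβ1⟩ := hz
    have hβ0 : 0 < β₁ := by
      have hlog4' : 1 < Real.log 4 := by
        rw [show (4:ℝ) = 2 ^ 2 by norm_num, Real.log_pow]; have := Real.log_two_gt_d9; push_cast; linarith
      have : c / (Real.log ((NumberField.discr N).natAbs : ℝ) + Real.log 4) ≤ 1 := by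
        rw [div_le_one (by linarith)]
        have : c ≤ 1 := hc4.trans (by norm_num)
        linarith
      linarith
    obtain ⟨hI0, hIh⟩ := rpow_window_div_mem hx1 hh0 hβ0 hβ1.le
    obtain ⟨hBp, hBm⟩ := hB β₁ hζ hwin hβ1
    have hIdC : 0 ≤ dC * (((x + h) ^ β₁ - x ^ β₁) / β₁) := mul_nonneg hdC0 hI0
    have hIdC' : dC * (((x + h) ^ β₁ - x ^ β₁) / β₁) ≤ dC * h := mul_le_mul_of_nonneg_left hIh hdC0
    by_cases hζE : dedekindZeta₁ (IntermediateField.fixedField (Subgroup.zpowers σ)) β₁ = 0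
    · have h1 := abs_le.1 (hBp hζE)
      refine ⟨by nlinarith [h1.2], fun hno => absurd hζE (hno β₁ hζ hwin hβ1)⟩
    · have h1 := abs_le.1 (hBm hζE)
      exact ⟨by nlinarith [h1.2], fun _ => by nlinarith [h1.1]⟩
  · have h1 := abs_le.1 (hA hz)
    exact ⟨by nlinarith [h1.2], fun _ => by nlinarith [h1.1]⟩

/-- **Primes with prescribed Frobenius in short intervals.**  With `δ, L, c` of `frobeniusClass_shortInterval_bounds`
(at `κ = 1/2`): for every Galois `N/ℚ` of degree `n`, every `σ`, every `x ≥ |d_N|^L` and `x^{1−δ} ≤ h ≤ x`, if no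
real zero `β₁` of `ζ₁_N` in the window has `ζ₁_{N^{⟨σ⟩}}(β₁) = 0`, then some prime `p ∈ (x, x+h]`, `p ∤ d_N`, has a
prime of `N` above it, unramified, at which a conjugate of `σ` is the Frobenius. -/
theorem exists_prime_frobenius_mem_shortInterval (n : ℕ) (hn : 1 < n) :
    ∃ δ L c : ℝ, 0 < δ ∧ δ ≤ 1 / 64 ∧ 0 < L ∧ 0 < c ∧ c ≤ 1 / (8 * ((2 * n).factorial : ℝ)) ∧
      ∀ (N : Type) [Field N] [NumberField N] [IsGalois ℚ N], Module.finrank ℚ N = n → ∀ σ : N ≃ₐ[ℚ] N,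
      ∀ x h : ℝ, ((NumberField.discr N).natAbs : ℝ) ^ L ≤ x → x ^ (1 - δ) ≤ h → h ≤ x →
        (∀ β₁ : ℝ, dedekindZeta₁ N β₁ = 0 →
            1 - c / (Real.log ((NumberField.discr N).natAbs : ℝ) + Real.log 4) < β₁ → β₁ < 1 →
            dedekindZeta₁ (IntermediateField.fixedField (Subgroup.zpowers σ)) β₁ ≠ 0) →
        ∃ p : ℕ, p.Prime ∧ x < p ∧ (p : ℝ) ≤ x + h ∧ ¬ ((p : ℤ) ∣ NumberField.discr N) ∧
          ∃ (Q : Ideal (𝓞 N)) (_ : Q.IsMaximal) (_ : Q.LiesOver (span {(p : ℤ)})) (φ g : N ≃ₐ[ℚ] N),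
            IsArithFrobAt ℤ φ Q ∧ Q.inertia (N ≃ₐ[ℚ] N) = ⊥ ∧ g * φ * g⁻¹ = σ := by
  obtain ⟨δ, L, c, hδ0, hδ64, hL0, hc0, hcfac, hmain⟩ :=
    frobeniusClass_shortInterval_bounds n hn (κ := 1 / 2) (by norm_num) (by norm_num)
  refine ⟨δ, L, c, hδ0, hδ64, hL0, hc0, hcfac, fun N _ _ _ hN σ x h hx hhx hhx' hno => ?_⟩
  obtain ⟨-, hlow⟩ := hmain N hN σ x h hx hhx hhx'
  have hN1 : 1 < Module.finrank ℚ N := by rw [hN]; exact hn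
  have hd3 : (3 : ℝ) ≤ ((NumberField.discr N).natAbs : ℝ) := three_le_natAbs_discr_real N hN1
  have hx1 : 1 ≤ x := le_trans (Real.one_le_rpow (by linarith) hL0.le) hx
  have hx0 : 0 < x := by linarith
  have hh0 : 0 < h := lt_of_lt_of_le (Real.rpow_pos_of_pos hx0 _) hhx
  have hdC0 : 0 < (Nat.card {τ : N ≃ₐ[ℚ] N // IsConj σ τ} : ℝ) / Nat.card (N ≃ₐ[ℚ] N) := by
    have h1 : 0 < Nat.card {τ : N ≃ₐ[ℚ] N // IsConj σ τ} := by
      haveI : Nonempty {τ : N ≃ₐ[ℚ] N // IsConj σ τ} := ⟨⟨σ, IsConj.refl σ⟩⟩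
      exact Nat.card_pos
    have h2 : 0 < Nat.card (N ≃ₐ[ℚ] N) := Nat.card_pos
    exact div_pos (by exact_mod_cast h1) (by exact_mod_cast h2)
  have hpos := hlow hno
  set P : ℕ → Prop := fun p : ℕ => ¬ ((p : ℤ) ∣ NumberField.discr N) ∧
    ∃ (Q : Ideal (𝓞 N)) (_ : Q.IsMaximal) (_ : Q.LiesOver (span {(p : ℤ)})) (φ g : N ≃ₐ[ℚ] N),
      IsArithFrobAt ℤ φ Q ∧ Q.inertia (N ≃ₐ[ℚ] N) = ⊥ ∧ g * φ * g⁻¹ = σ with hP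
  have hsub : (Nat.primesLE ⌊x⌋₊).filter P ⊆ (Nat.primesLE ⌊x + h⌋₊).filter P := by
    intro p hp
    rw [Finset.mem_filter, Nat.primesLE_eq_filter_range, Finset.mem_filter, Finset.mem_range] at hp ⊢
    refine ⟨⟨?_, hp.1.2⟩, hp.2⟩
    have : ⌊x⌋₊ ≤ ⌊x + h⌋₊ := Nat.floor_le_floor (by linarith)
    omega
  have hdiff : (∑ p ∈ (Nat.primesLE ⌊x + h⌋₊).filter P, Real.log p) - (∑ p ∈ (Nat.primesLE ⌊x⌋₊).filter P, Real.log p) =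
      ∑ p ∈ (Nat.primesLE ⌊x + h⌋₊).filter P \ (Nat.primesLE ⌊x⌋₊).filter P, Real.log p := by
    rw [← Finset.sum_sdiff hsub]; ring
  have hS : 0 < ∑ p ∈ (Nat.primesLE ⌊x + h⌋₊).filter P \ (Nat.primesLE ⌊x⌋₊).filter P, Real.log p := by
    rw [← hdiff]; nlinarith
  obtain ⟨p, hp, -⟩ := Finset.exists_ne_zero_of_sum_ne_zero hS.ne'
  rw [Finset.mem_sdiff, Finset.mem_filter, Nat.primesLE_eq_filter_range, Finset.mem_filter, Finset.mem_range] at hp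
  obtain ⟨⟨⟨hple, hprime⟩, hPp⟩, hnot⟩ := hp
  have hpgt : ⌊x⌋₊ < p := by
    by_contra hle
    push Not at hle
    exact hnot (by
      rw [Finset.mem_filter, Nat.primesLE_eq_filter_range, Finset.mem_filter, Finset.mem_range]
      exact ⟨⟨by omega, hprime⟩, hPp⟩)
  refine ⟨p, hprime, Nat.lt_of_floor_lt hpgt, ?_, hPp.1, hPp.2⟩
  have : (p : ℝ) ≤ ⌊x + h⌋₊ := by exact_mod_cast Nat.le_of_lt_succ hple
  exact this.trans (Nat.floor_le (by linarith))

/-- **Odd degree: the Chebotarev density theorem in short intervals holds for EVERY class, unconditionally**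
(a Galois field of odd degree has no exceptional zero, [Stark1974, Thm. 3]): `|Δ − δ_C h| ≤ κ δ_C h`. -/
theorem frobeniusClass_shortInterval_of_odd (n : ℕ) (hn : 1 < n) (hodd : Odd n) {κ : ℝ} (hκ : 0 < κ)
    (hκ1 : κ ≤ 1) :
    ∃ δ L : ℝ, 0 < δ ∧ δ ≤ 1 / 64 ∧ 0 < L ∧
      ∀ (N : Type) [Field N] [NumberField N] [IsGalois ℚ N], Module.finrank ℚ N = n → ∀ σ : N ≃ₐ[ℚ] N,
      ∀ x h : ℝ, ((NumberField.discr N).natAbs : ℝ) ^ L ≤ x → x ^ (1 - δ) ≤ h → h ≤ x →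
        |(∑ p ∈ (Nat.primesLE ⌊x + h⌋₊).filter
            (fun p : ℕ => ¬ ((p : ℤ) ∣ NumberField.discr N) ∧
              ∃ (Q : Ideal (𝓞 N)) (_ : Q.IsMaximal) (_ : Q.LiesOver (span {(p : ℤ)})) (φ g : N ≃ₐ[ℚ] N),
                IsArithFrobAt ℤ φ Q ∧ Q.inertia (N ≃ₐ[ℚ] N) = ⊥ ∧ g * φ * g⁻¹ = σ), Real.log p) -
          (∑ p ∈ (Nat.primesLE ⌊x⌋₊).filter
            (fun p : ℕ => ¬ ((p : ℤ) ∣ NumberField.discr N) ∧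
              ∃ (Q : Ideal (𝓞 N)) (_ : Q.IsMaximal) (_ : Q.LiesOver (span {(p : ℤ)})) (φ g : N ≃ₐ[ℚ] N),
                IsArithFrobAt ℤ φ Q ∧ Q.inertia (N ≃ₐ[ℚ] N) = ⊥ ∧ g * φ * g⁻¹ = σ), Real.log p) -
          (Nat.card {τ : N ≃ₐ[ℚ] N // IsConj σ τ} : ℝ) / Nat.card (N ≃ₐ[ℚ] N) * h| ≤
          κ * ((Nat.card {τ : N ≃ₐ[ℚ] N // IsConj σ τ} : ℝ) / Nat.card (N ≃ₐ[ℚ] N) * h) := by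
  obtain ⟨δ, L, c, hδ0, hδ64, hL0, hc0, -, hcfac, hmain⟩ := frobeniusClass_shortInterval n hn hκ hκ1
  refine ⟨δ, L, hδ0, hδ64, hL0, fun N _ _ _ hN σ x h hx hhx hhx' => ?_⟩
  obtain ⟨hA, -⟩ := hmain N hN σ x h hx hhx hhx'
  refine hA ?_
  rintro ⟨β₁, hζ, hwin, hβ1⟩
  have hN1 : 1 < Module.finrank ℚ N := by rw [hN]; exact hn
  have hoddN : Odd (Module.finrank ℚ N) := by rw [hN]; exact hodd
  have hd3 : (3 : ℝ) ≤ ((NumberField.discr N).natAbs : ℝ) := three_le_natAbs_discr_real N hN1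
  have hlogd : 0 < Real.log ((NumberField.discr N).natAbs : ℝ) := Real.log_pos (by linarith)
  have hlog4 : 0 < Real.log 4 := Real.log_pos (by norm_num)
  -- `β₁` lies in Stark's range
  have hσ : 1 - 1 / (8 * ((2 * Module.finrank ℚ N).factorial : ℝ) *
      Real.log ((NumberField.discr N).natAbs : ℝ)) ≤ β₁ := by
    rw [hN]
    have h1 : c / (Real.log ((NumberField.discr N).natAbs : ℝ) + Real.log 4) ≤
        c / Real.log ((NumberField.discr N).natAbs : ℝ) :=
      div_le_div_of_nonneg_left hc0.le hlogd (by linarith)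
    have h2 : c / Real.log ((NumberField.discr N).natAbs : ℝ) ≤
        (1 / (8 * ((2 * n).factorial : ℝ))) / Real.log ((NumberField.discr N).natAbs : ℝ) :=
      div_le_div_of_nonneg_right hcfac hlogd.le
    have h3 : (1 / (8 * ((2 * n).factorial : ℝ))) / Real.log ((NumberField.discr N).natAbs : ℝ) =
        1 / (8 * ((2 * n).factorial : ℝ) * Real.log ((NumberField.discr N).natAbs : ℝ)) := by
      rw [div_div]
    linarith
  have hβ1ne : ((β₁ : ℝ) : ℂ) ≠ 1 := by
    intro h'; apply hβ1.ne; exact_mod_cast h'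
  have hLzero : classGroupLFunction N 1 β₁ = 0 := by
    have := classGroupLFunction_eq_zero_of_famF (K := N) 0 (ρ := (β₁ : ℂ)) (by rw [famF_zero]; exact hζ) hβ1ne
    rwa [toHomUnits_toMulHom_zero] at this
  have h11 : (1 : ClassGroup (𝓞 N) →* ℂˣ) * 1 = 1 := by ext; simp
  exact classGroupLFunction_ne_zero_of_odd N hoddN hN1 1 h11 hσ hβ1 hLzero

/-- **Odd degree: primes with prescribed Frobenius class in every short interval** `(x, x+h]`,
`x ≥ |d_N|^L`, `x^{1−δ} ≤ h ≤ x`, for EVERY conjugacy class of every Galois field of odd degree `n > 1`,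
unconditionally. -/
theorem exists_prime_frobenius_mem_shortInterval_of_odd (n : ℕ) (hn : 1 < n) (hodd : Odd n) :
    ∃ δ L : ℝ, 0 < δ ∧ δ ≤ 1 / 64 ∧ 0 < L ∧
      ∀ (N : Type) [Field N] [NumberField N] [IsGalois ℚ N], Module.finrank ℚ N = n → ∀ σ : N ≃ₐ[ℚ] N,
      ∀ x h : ℝ, ((NumberField.discr N).natAbs : ℝ) ^ L ≤ x → x ^ (1 - δ) ≤ h → h ≤ x →
        ∃ p : ℕ, p.Prime ∧ x < p ∧ (p : ℝ) ≤ x + h ∧ ¬ ((p : ℤ) ∣ NumberField.discr N) ∧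
          ∃ (Q : Ideal (𝓞 N)) (_ : Q.IsMaximal) (_ : Q.LiesOver (span {(p : ℤ)})) (φ g : N ≃ₐ[ℚ] N),
            IsArithFrobAt ℤ φ Q ∧ Q.inertia (N ≃ₐ[ℚ] N) = ⊥ ∧ g * φ * g⁻¹ = σ := by
  obtain ⟨δ, L, c, hδ0, hδ64, hL0, hc0, hcfac, hmain⟩ := exists_prime_frobenius_mem_shortInterval n hn
  refine ⟨δ, L, hδ0, hδ64, hL0, fun N _ _ _ hN σ x h hx hhx hhx' => hmain N hN σ x h hx hhx hhx' ?_⟩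
  intro β₁ hζ hwin hβ1 _
  have hN1 : 1 < Module.finrank ℚ N := by rw [hN]; exact hn
  have hoddN : Odd (Module.finrank ℚ N) := by rw [hN]; exact hodd
  have hd3 : (3 : ℝ) ≤ ((NumberField.discr N).natAbs : ℝ) := three_le_natAbs_discr_real N hN1
  have hlogd : 0 < Real.log ((NumberField.discr N).natAbs : ℝ) := Real.log_pos (by linarith)
  have hlog4 : 0 < Real.log 4 := Real.log_pos (by norm_num)
  have hσ : 1 - 1 / (8 * ((2 * Module.finrank ℚ N).factorial : ℝ) *
      Real.log ((NumberField.discr N).natAbs : ℝ)) ≤ β₁ := by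
    rw [hN]
    have h1 : c / (Real.log ((NumberField.discr N).natAbs : ℝ) + Real.log 4) ≤
        c / Real.log ((NumberField.discr N).natAbs : ℝ) :=
      div_le_div_of_nonneg_left hc0.le hlogd (by linarith)
    have h2 : c / Real.log ((NumberField.discr N).natAbs : ℝ) ≤
        (1 / (8 * ((2 * n).factorial : ℝ))) / Real.log ((NumberField.discr N).natAbs : ℝ) :=
      div_le_div_of_nonneg_right hcfac hlogd.le
    have h3 : (1 / (8 * ((2 * n).factorial : ℝ))) / Real.log ((NumberField.discr N).natAbs : ℝ) =
        1 / (8 * ((2 * n).factorial : ℝ) * Real.log ((NumberField.discr N).natAbs : ℝ)) := by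
      rw [div_div]
    linarith
  have hβ1ne : ((β₁ : ℝ) : ℂ) ≠ 1 := by
    intro h'; apply hβ1.ne; exact_mod_cast h'
  have hLzero : classGroupLFunction N 1 β₁ = 0 := by
    have := classGroupLFunction_eq_zero_of_famF (K := N) 0 (ρ := (β₁ : ℂ)) (by rw [famF_zero]; exact hζ) hβ1ne
    rwa [toHomUnits_toMulHom_zero] at this
  have h11 : (1 : ClassGroup (𝓞 N) →* ℂˣ) * 1 = 1 := by ext; simp
  exact classGroupLFunction_ne_zero_of_odd N hoddN hN1 1 h11 hσ hβ1 hLzero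

end Summit.QuantumAdvantage.QuantumAdvantage.Theorems.DegreeOnePrimesEscape

end
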